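import Mathlib.Analysis.InnerProductSpace.Projection.Reflection
import Literature.MathematicalPhysics.QuantumFieldTheory.MirrorRPKernel
import Literature.Analysis.Complex.BernsteinWidderHalfPlane
import HarnessLib

/-!
# Reflection positivity in one mirror ⇒ holomorphic continuation in the normal variable

The converse ("hard") direction of the Osterwalder–Schrader / Widder dictionary for a translation-invariant
kernel that is reflection positive with respect to ONE hyperplane mirror (`IsMirrorRPKernel`, finite sums over
points of the open half-space; `Literature/MathematicalPhysics/QuantumFieldTheory/MirrorRPKernel.lean` lists this
as the wanted next theorem):

**Theorem (`IsMirrorRPKernel.exists_halfPlane_continuation`).**  Let `E` be a real inner product space,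
`K : E → ℝ` continuous off `0`, even, bounded on every closed half-space `{⟪x, n̂⟫ ≥ t₀}` (`t₀ > 0`), invariant
under the mirror `n^⊥` and reflection positive for it (`n ≠ 0`).  Then for every transverse offset `y ⊥ n` the
function `t ↦ K(t n̂ + y)` (`t > 0`, `n̂ = n/‖n‖`) is the restriction of a function holomorphic on the open right
half-plane and dominated there by `K((Re t) n̂)` [cite: GlimmJaffeQP1987, Thm. 6.1.3 and §6.1 (reflection positivity
⇒ self-adjoint contraction semigroup `e^{-tH}`, `t ↦ ⟨θf, T(t) f⟩` a Laplace transform)], [cite: Widder1941,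
Ch. VI Thm. 21 (exponentially convex functions are Laplace–Stieltjes transforms)].

**Proof (measure-free).**  POLARISATION (`sum_mul_mul_polarised_nonneg`): the configuration `{sₐ n̂} ∪ {sₐ n̂ - y}`
(`sₐ > 0`, all in the open half-space) has Gram matrix `[[A, B], [B, A]]` with `A_ab = K((sₐ+s_b)n̂)`,
`B_ab = K((sₐ+s_b)n̂ + y)` (mirror invariance + evenness identify the two off-diagonal blocks), so reflection
positivity with coefficients `(cₐ, ±cₐ)` gives `A ± B ⪰ 0`: the two functions `F_±(s) = K(s n̂) ± K(s n̂ + y)` are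
positive definite on the semigroup `((0,∞),+)`, bounded on `[t₀,∞)` by the slab bound and continuous.
BERNSTEIN–WIDDER (`Literature.Analysis.Complex.exists_differentiableOn_halfPlane_of_isSemigroupPosDef`, proved in the
tree without measures: alternating differences ⇒ smooth completely monotone approximants ⇒ little Bernstein
theorem ⇒ Vitali) extends each `F_±` holomorphically to `{Re t > 0}` with `|Φ_±(t)| ≤ F_±(Re t)`;
`F := (Φ_+ - Φ_-)/2` is the required extension and `‖F t‖ ≤ (F_+ + F_-)(Re t)/2 = K((Re t) n̂)`.
-/

noncomputable section

open Set Filter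
open scoped InnerProductSpace BigOperators

namespace Literature.MathematicalPhysics.QuantumFieldTheory

open Literature.Analysis.SpecialFunctions Literature.Analysis.Complex

variable {E : Type*} [NormedAddCommGroup E] [InnerProductSpace ℝ E]

/-! ### Geometry of the unit normal -/

/-- `⟪n̂, n⟫ = ‖n‖` for `n̂ = ‖n‖⁻¹ n`. [folklore] -/
theorem inner_unitNormal_normal (n : E) (hn : n ≠ 0) : ⟪‖n‖⁻¹ • n, n⟫_ℝ = ‖n‖ := by
  rw [real_inner_smul_left, real_inner_self_eq_norm_sq]
  have : ‖n‖ ≠ 0 := norm_ne_zero_iff.mpr hn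
  field_simp

/-- `⟪n̂, n̂⟫ = 1` for `n̂ = ‖n‖⁻¹ n`, `n ≠ 0`. [folklore] -/
theorem inner_unitNormal_self (n : E) (hn : n ≠ 0) : ⟪‖n‖⁻¹ • n, ‖n‖⁻¹ • n⟫_ℝ = 1 := by
  rw [real_inner_smul_right, inner_unitNormal_normal n hn]
  exact inv_mul_cancel₀ (norm_ne_zero_iff.mpr hn)

/-- The mirror reflection negates the unit normal direction: `θ_n (s n̂) = -(s n̂)`. [folklore] -/
theorem reflection_smul_unitNormal (n : E) (s : ℝ) :
    (ℝ ∙ n)ᗮ.reflection (s • ‖n‖⁻¹ • n) = -(s • ‖n‖⁻¹ • n) := by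
  rw [smul_smul, map_smul, mirrorReflection_normal, smul_neg]

/-- The mirror reflection of `s n̂ - y`, `y ⊥ n`, is `-(s n̂) - y`. [folklore] -/
theorem reflection_smul_unitNormal_sub (n : E) {y : E} (hy : ⟪y, n⟫_ℝ = 0) (s : ℝ) :
    (ℝ ∙ n)ᗮ.reflection (s • ‖n‖⁻¹ • n - y) = -(s • ‖n‖⁻¹ • n) - y := by
  rw [map_sub, reflection_smul_unitNormal, mirrorReflection_of_inner_eq_zero hy]

/-! ### Polarisation: the two positive definite functions `F_± (s) = K(s n̂) ± K(s n̂ + y)` -/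

/-- **Polarisation.**  For `K` even and invariant under the mirror `n^⊥`, reflection positive for
`n ≠ 0`, and `y ⊥ n`, the functions `F_±(s) = K(s n̂) ± K(s n̂ + y)` are positive definite on the
semigroup `((0,∞),+)` (configuration `{sₐ n̂} ∪ {sₐ n̂ - y}` with coefficients `(cₐ, ±cₐ)`).
[cite: GlimmJaffeQP1987, §6.1 Thm. 6.1.3] -/
theorem IsMirrorRPKernel.sum_mul_mul_polarised_nonneg {K : E → ℝ} {n : E} (hn : n ≠ 0) (heven : ∀ x, K (-x) = K x)
    (hinv : ∀ x, K ((ℝ ∙ n)ᗮ.reflection x) = K x) (hRP : IsMirrorRPKernel n K) {y : E}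
    (hy : ⟪y, n⟫_ℝ = 0) {ε : ℝ} (hε : ε = 1 ∨ ε = -1) :
    (∀ (m : ℕ) (s c : Fin m → ℝ), (∀ k₀, 0 < s k₀) → 0 ≤ ∑ i₁, ∑ i₂, c i₁ * c i₂ * (K ((s i₁ + s i₂) • ‖n‖⁻¹ • n) + ε * K ((s i₁ + s i₂) • ‖n‖⁻¹ • n + y))) := by
  intro m s c hs
  -- the doubled configuration
  let p : Fin m ⊕ Fin m → E := Sum.elim (fun a => s a • ‖n‖⁻¹ • n) (fun a => s a • ‖n‖⁻¹ • n - y)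
  let d : Fin m ⊕ Fin m → ℝ := Sum.elim c (fun a => ε * c a)
  have hp : ∀ i, 0 < ⟪p i, n⟫_ℝ := by
    have hpos : ∀ a, 0 < ⟪s a • ‖n‖⁻¹ • n, n⟫_ℝ := fun a => by
      rw [real_inner_smul_left, inner_unitNormal_normal n hn]
      exact mul_pos (hs a) (norm_pos_iff.mpr hn)
    rintro (a | a)
    · exact hpos a
    · show 0 < ⟪s a • ‖n‖⁻¹ • n - y, n⟫_ℝ
      rw [inner_sub_left, hy, sub_zero]; exact hpos a
  have h0 := hRP.sum_nonneg p d hp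
  -- evaluate the four blocks
  have hε2 : ε * ε = 1 := by rcases hε with rfl | rfl <;> norm_num
  have eA : ∀ a b : Fin m, K (s a • ‖n‖⁻¹ • n - (ℝ ∙ n)ᗮ.reflection (s b • ‖n‖⁻¹ • n)) =
      K ((s a + s b) • ‖n‖⁻¹ • n) := fun a b => by
    rw [reflection_smul_unitNormal, sub_neg_eq_add, ← add_smul]
  have eB : ∀ a b : Fin m, K (s a • ‖n‖⁻¹ • n - (ℝ ∙ n)ᗮ.reflection (s b • ‖n‖⁻¹ • n - y)) =
      K ((s a + s b) • ‖n‖⁻¹ • n + y) := fun a b => by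
    rw [reflection_smul_unitNormal_sub n hy, show s a • ‖n‖⁻¹ • n - (-(s b • ‖n‖⁻¹ • n) - y) =
      (s a + s b) • ‖n‖⁻¹ • n + y by rw [add_smul]; abel]
  have eB' : ∀ a b : Fin m, K (s a • ‖n‖⁻¹ • n - y - (ℝ ∙ n)ᗮ.reflection (s b • ‖n‖⁻¹ • n)) =
      K ((s a + s b) • ‖n‖⁻¹ • n + y) := fun a b => by
    -- `K(v - y) = K(θ(v - y)) = K(-v - y) = K(v + y)` by invariance and evenness
    rw [reflection_smul_unitNormal, show s a • ‖n‖⁻¹ • n - y - -(s b • ‖n‖⁻¹ • n) =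
      (s a + s b) • ‖n‖⁻¹ • n - y by rw [add_smul]; abel]
    rw [← hinv ((s a + s b) • ‖n‖⁻¹ • n - y), reflection_smul_unitNormal_sub n hy, ← heven]
    congr 1; abel
  have eA' : ∀ a b : Fin m, K (s a • ‖n‖⁻¹ • n - y - (ℝ ∙ n)ᗮ.reflection (s b • ‖n‖⁻¹ • n - y)) =
      K ((s a + s b) • ‖n‖⁻¹ • n) := fun a b => by
    rw [reflection_smul_unitNormal_sub n hy, show s a • ‖n‖⁻¹ • n - y - (-(s b • ‖n‖⁻¹ • n) - y) =
      (s a + s b) • ‖n‖⁻¹ • n by rw [add_smul]; abel]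
  have hexp : ∑ i, ∑ j, d i * d j * K (p i - (ℝ ∙ n)ᗮ.reflection (p j)) =
      2 * ∑ a, ∑ b, c a * c b *
        (K ((s a + s b) • ‖n‖⁻¹ • n) + ε * K ((s a + s b) • ‖n‖⁻¹ • n + y)) := by
    simp only [Fintype.sum_sum_type, p, d, Sum.elim_inl, Sum.elim_inr, eA, eB, eB', eA',
      ← Finset.sum_add_distrib, Finset.mul_sum]
    refine Finset.sum_congr rfl fun a _ => Finset.sum_congr rfl fun b _ => ?_
    linear_combination (c a * c b * K ((s a + s b) • ‖n‖⁻¹ • n)) * hε2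
  rw [hexp] at h0
  linarith

/-- The polarised functions are bounded above on every `[t₀,∞)` under the slab bound on `K`. [folklore] -/
theorem polarised_le_of_slab_bound {K : E → ℝ} {n : E} (hn : n ≠ 0)
    (hslab : ∀ t₀ : ℝ, 0 < t₀ → ∃ M : ℝ, ∀ x : E, t₀ ≤ ⟪x, ‖n‖⁻¹ • n⟫_ℝ → |K x| ≤ M) {y : E}
    (hy : ⟪y, n⟫_ℝ = 0) {ε : ℝ} (hε : ε = 1 ∨ ε = -1) :
    (∀ t₀ : ℝ, 0 < t₀ → ∃ M : ℝ, ∀ τ : ℝ, t₀ ≤ τ → (K (τ • ‖n‖⁻¹ • n) + ε * K (τ • ‖n‖⁻¹ • n + y)) ≤ M) := by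
  intro t₀ ht₀
  obtain ⟨M, hM⟩ := hslab t₀ ht₀
  refine ⟨M + M, fun t ht => ?_⟩
  have h1 : ⟪t • ‖n‖⁻¹ • n, ‖n‖⁻¹ • n⟫_ℝ = t := by
    rw [real_inner_smul_left, inner_unitNormal_self n hn, mul_one]
  have h2 : ⟪t • ‖n‖⁻¹ • n + y, ‖n‖⁻¹ • n⟫_ℝ = t := by
    rw [inner_add_left, h1, real_inner_smul_right, hy, mul_zero, add_zero]
  have b1 := hM (t • ‖n‖⁻¹ • n) (by rw [h1]; exact ht)
  have b2 := hM (t • ‖n‖⁻¹ • n + y) (by rw [h2]; exact ht)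
  have hεabs : |ε| = 1 := by rcases hε with rfl | rfl <;> norm_num
  calc K (t • ‖n‖⁻¹ • n) + ε * K (t • ‖n‖⁻¹ • n + y)
      ≤ |K (t • ‖n‖⁻¹ • n)| + |ε * K (t • ‖n‖⁻¹ • n + y)| := add_le_add (le_abs_self _) (le_abs_self _)
    _ = |K (t • ‖n‖⁻¹ • n)| + |K (t • ‖n‖⁻¹ • n + y)| := by rw [abs_mul, hεabs, one_mul]
    _ ≤ M + M := add_le_add b1 b2

/-- The polarised functions are continuous on `(0,∞)` when `K` is continuous off the origin. [folklore] -/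
theorem continuousOn_polarised {K : E → ℝ} {n : E} (hn : n ≠ 0) (hK : ContinuousOn K {0}ᶜ)
    {y : E} (hy : ⟪y, n⟫_ℝ = 0) (ε : ℝ) :
    ContinuousOn (fun s : ℝ => K (s • ‖n‖⁻¹ • n) + ε * K (s • ‖n‖⁻¹ • n + y)) (Ioi 0) := by
  have hne1 : ∀ t : ℝ, 0 < t → t • ‖n‖⁻¹ • n ≠ 0 := by
    intro t ht h
    have := congr_arg (fun x => ⟪x, n⟫_ℝ) h
    simp only [real_inner_smul_left, inner_unitNormal_normal n hn, inner_zero_left] at this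
    exact (mul_pos ht (norm_pos_iff.mpr hn)).ne' this
  have hne2 : ∀ t : ℝ, 0 < t → t • ‖n‖⁻¹ • n + y ≠ 0 := by
    intro t ht h
    have := congr_arg (fun x => ⟪x, n⟫_ℝ) h
    simp only [inner_add_left, real_inner_smul_left, inner_unitNormal_normal n hn, hy, add_zero,
      inner_zero_left] at this
    exact (mul_pos ht (norm_pos_iff.mpr hn)).ne' this
  have c1 : Continuous (fun t : ℝ => t • ‖n‖⁻¹ • n) := continuous_id.smul continuous_const
  have c2 : Continuous (fun t : ℝ => t • ‖n‖⁻¹ • n + y) := c1.add continuous_const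
  refine ContinuousOn.add (hK.comp c1.continuousOn fun t ht => hne1 t ht) ?_
  exact continuousOn_const.mul (hK.comp c2.continuousOn fun t ht => hne2 t ht)

/-! ### The continuation theorem -/

/-- **Reflection positivity in one mirror ⇒ holomorphic continuation in the normal variable.**  For `K` continuous
off `0`, even, bounded on every closed half-space `{⟪x, n̂⟫ ≥ t₀}` (`t₀ > 0`), invariant under the mirror `n^⊥`
and reflection positive for it (`n ≠ 0`), and every `y ⊥ n`: `t ↦ K(t n̂ + y)` (`t > 0`) is the restriction of a
function holomorphic on `{Re t > 0}` with `‖F t‖ ≤ K((Re t) n̂)`.  (Polarisation + the measure-free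
Bernstein–Widder continuation of the tree.) [cite: GlimmJaffeQP1987, §6.1 Thm. 6.1.3] -/
theorem IsMirrorRPKernel.exists_halfPlane_continuation {K : E → ℝ} {n : E} (hn : n ≠ 0)
    (hK : ContinuousOn K {0}ᶜ) (heven : ∀ x, K (-x) = K x)
    (hslab : ∀ t₀ : ℝ, 0 < t₀ → ∃ M : ℝ, ∀ x : E, t₀ ≤ ⟪x, ‖n‖⁻¹ • n⟫_ℝ → |K x| ≤ M)
    (hinv : ∀ x, K ((ℝ ∙ n)ᗮ.reflection x) = K x) (hRP : IsMirrorRPKernel n K) {y : E} (hy : ⟪y, n⟫_ℝ = 0) :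
    ∃ F : ℂ → ℂ, DifferentiableOn ℂ F {t : ℂ | 0 < t.re} ∧
      (∀ t : ℝ, 0 < t → F t = ((K (t • ‖n‖⁻¹ • n + y) : ℝ) : ℂ)) ∧
      (∀ t : ℂ, 0 < t.re → ‖F t‖ ≤ K (t.re • ‖n‖⁻¹ • n)) := by
  -- the two positive definite, bounded, continuous functions
  have hP : ∀ ε : ℝ, ε = 1 ∨ ε = -1 → ∃ Φ : ℂ → ℂ, DifferentiableOn ℂ Φ {z : ℂ | 0 < z.re} ∧
      (∀ t : ℝ, 0 < t → Φ t = ((K (t • ‖n‖⁻¹ • n) + ε * K (t • ‖n‖⁻¹ • n + y) : ℝ) : ℂ)) ∧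
      ∀ z : ℂ, 0 < z.re → ‖Φ z‖ ≤ K (z.re • ‖n‖⁻¹ • n) + ε * K (z.re • ‖n‖⁻¹ • n + y) := fun ε hε =>
    exists_differentiableOn_halfPlane_of_isSemigroupPosDef
      (f := fun s : ℝ => K (s • ‖n‖⁻¹ • n) + ε * K (s • ‖n‖⁻¹ • n + y))
      (continuousOn_polarised hn hK hy ε)
      (hRP.sum_mul_mul_polarised_nonneg hn heven hinv hy hε) (polarised_le_of_slab_bound hn hslab hy hε)
  obtain ⟨Φp, hΦp_d, hΦp_r, hΦp_b⟩ := hP 1 (Or.inl rfl)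
  obtain ⟨Φm, hΦm_d, hΦm_r, hΦm_b⟩ := hP (-1) (Or.inr rfl)
  refine ⟨fun z => (Φp z - Φm z) / 2, (hΦp_d.sub hΦm_d).div_const 2, fun t ht => ?_, fun z hz => ?_⟩
  · simp only [hΦp_r t ht, hΦm_r t ht]
    push_cast; ring
  · have h1 := hΦp_b z hz
    have h2 := hΦm_b z hz
    calc ‖(Φp z - Φm z) / 2‖ = ‖Φp z - Φm z‖ / 2 := by
          rw [norm_div, RCLike.norm_ofNat]
      _ ≤ (‖Φp z‖ + ‖Φm z‖) / 2 := by gcongr; exact norm_sub_le _ _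
      _ ≤ ((K (z.re • ‖n‖⁻¹ • n) + 1 * K (z.re • ‖n‖⁻¹ • n + y)) +
            (K (z.re • ‖n‖⁻¹ • n) + (-1) * K (z.re • ‖n‖⁻¹ • n + y))) / 2 := by gcongr
      _ = K (z.re • ‖n‖⁻¹ • n) := by ring

end Literature.MathematicalPhysics.QuantumFieldTheory
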